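import Summits.QuantumFields.YangMills.Theorems.BalabanUVNodesN13UV01LevelZeroOfPartialSumFloorAtRecord13
import Summits.QuantumFields.YangMills.Theorems.BalabanUVNodesN13NormalisationNoGoCouplingBlindAtRecord13SepCoPHV

/-!
# BalabanUVNodes ∕ N13 — [III] Cor. 3 (2.50) AT LEVEL `0` WITH THE NORMALISATION LETTERS `Efl`, `logz` AS PRINTED: four DISPLAYED reader's items of [I] (0.15) ∕ [I] (2.13)–(2.14)
# shape replace the coupling-blind letters `Efl = logz = 0` of p586609 ∕ p590719 ∕ p632548 (which become the degenerate instance `a = C = 0`); print's `z` on `SU(N)` meets the z-items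

Cell `pub-ymgap` (D-0062 Track A ∕ D-0149 width), WIDTH SEAT `pub-ymgap-dag-n13-w1` (gen 6, CLAIM-1), key K1⁹ `StabilityBRunRowsAtRecordR13SepCoPHV` = stmt-QuantumFields-27364
(`route-QuantumFields-BalabanUVNodes` rev 29; `--kind proof --supports … --as helper`; count-neutral).  Successor task named in g5's ■ line and plan g86's «(iii) N13 at θZ = real work»;
director-ym №218 FLAG №9: K1⁹'s witness cannot be coupling-blind (dag-n13-w3 p636072), so the level-0 face of (B) must be available at GENERAL normalisation letters.

THE ITEMS (per run `P`, per step `j < K`, along the generated history `g_j = gOfRecord₁₃ θ P j`; all DISPLAYED HYPOTHESES, nothing asserted):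
z-LOWER `aL·log g_j − CzL ≤ logz_j` (`aL ≤ 4d(𝔤)`, `0 ≤ CzL`) · z-UPPER `logz_j ≤ aU·log g_j + CzU` (`aU ≤ 4d(𝔤)`, `0 ≤ CzU`) · Efl-LOWER `−CEL·|T₁^{(j+1)}| ≤ Efl_j` · Efl-UPPER
`Efl_j ≤ CEU·|T₁^{(j+1)}|` (`0 ≤ CEL, CEU`).  Print's `log z_j ≈ d(𝔤)·log g_j` ([I] (0.15) at `α = g_j²`) is `aL = d(𝔤)` — the tree's reader's item `B16B10Shape.CountertermData.ZLower`,
a KERNEL THEOREM on `SU(N)` (`B16ZLower.log_zNorm_specialUnitaryGroup_ge`) — with the trivial `z ≤ 1` as `aU = 0` (§5); the coupling-blind class is `aL = aU = 0`, all `C = 0`.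
THE ARITHMETIC.  With `Δ_j := |T₁^{(j)}| − |T₁^{(j+1)}| = (L⁴−1)|T₁^{(j+1)}| = ¼|T^{(j)*}|` (§1), (1.15) reads `e_j = (4d(𝔤)·log g_j + 4·log σ₀ − logz_j)·Δ_j + Efl_j` (§2); the z-items
turn the coupling logarithm into `(4d(𝔤) − a)·log g_j·Δ_j`, dropped when bounding `e_j` above (`log g_j ≤ 0`) and bounded by `(4d(𝔤) − aU)·(log g₀⁻¹ + M∕2)·Δ_j` when bounding `−e_j`
above under the coupling floor `g_j⁻² ≤ g₀⁻² + M` (p590719's logarithmic step; the floor is K1⁹'s row (iv), p632548 §1); `Σ_j Δ_j ≤ |T₁^{(0)}|`, `Σ_j |T₁^{(j+1)}| ≤ |T₁^{(0)}|∕15` (§3).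

CONTENTS.  §1 `sitesCard_sub_succ_eq`, `tstarCount_eq_four_mul_sub`, `sitesCard_sub_succ_nonneg`, `sum_sitesCard_succ_range_le`.  §2 `eStepOfRecord_eq_of_lt`, `eStepOfRecord_le_of_zLower_of_eflUpper`,
`neg_eStepOfRecord_le_of_zUpper_of_eflLower`.  §3 ★ `EOfRecord₁₃_le_of_inInterval_of_zLower_of_eflUpper` (`E ≤ (4·max(log σ₀,0) + CzL + CEU)·|T₁^{(0)}|`), ★ `neg_EOfRecord₁₃_le_of_inInterval_of_invSqFloor_of_zUpper_of_eflLower`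
(`−E ≤ ((4d(𝔤) − aU)(log g₀⁻¹ + M∕2) + 4·max(−log σ₀,0) + CzU + CEL)·|T₁^{(0)}|`).  §4 ★★ `uv_zero_densOfRecord₁₃_of_normLetters_of_inInterval_of_invSqFloor` (both sides of (2.50) at `k = 0`,
engines' currency), `uvIneq_zero_datumOfRecord₁₃CoPH_of_normLetters_…_of_invSqFloor` ∕ `…_of_runPartialSumFloor` ([B16]'s carrier at the construction of record; row (iv) spelling).  §5 bridges:
`normLetters_of_Efl_logz_zero` (blind class = instance), `countertermDataOfRecord_zLower_iff` ∕ `_eflBound_iff` (the tree predicates ARE the items, `aL = d(𝔤)`), `zNorm_SU_le_one`, `log_zNorm_SU_nonpos`,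
★ `zItems_of_logz_eq_log_zNorm` (print's `z` meets both z-items on windowed runs), ★★ `uv_zero_densOfRecord₁₃_of_logz_zNorm_of_eflAbs_of_inInterval_of_invSqFloor`.
The K1⁹ slot ∕ crux-by-name re-key of p632548 §4 to these items is the sibling file `…K1R9SlotOfAESuccNormalisationLettersAtRecord` (CLAIM-2).

HONEST FRAMING.  Elementary real arithmetic over the tree's `eStepOfRecord` ∕ `EOfRecord` at LEVEL 0 (explicit Wilson weight) plus one elementary measure fact (`z ≤ 1`); nothing of
Bałaban's Cor. 3 above level 0 asserted; the items are hypotheses (the z-lower one a tree theorem for SU(N) at print's `z`); K1⁹ NEITHER proved NOR refuted; N13 NOT discharged; no stub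
closed; counts unmoved (typed 28∕28 · discharged 5∕27 · A 5∕28); one finite `𝕋⁴_{L^K}` programme at fixed ε; R4 closes the CONDITIONAL finite-𝕋⁴ rung `BalabanLadder.UV` only — the
Yang–Mills mass gap (Clay) is NOT proved by any of this.  No `sorry`, `def`, `instance`, `notation`; standard axioms.
-/

noncomputable section

open scoped BigOperators

namespace Summit.QuantumFields.YangMills.BalabanUVNodes.N13UV01LevelZeroOfNormalisationLettersAtRecord13

open MeasureTheory
open Literature.MathematicalPhysics.QuantumFieldTheory.Balaban1983to89
open Literature.MathematicalPhysics.QuantumFieldTheory.Balaban1983to89.T4Continuum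
open Literature.MathematicalPhysics.QuantumFieldTheory.Balaban1983to89.Node00
open Literature.MathematicalPhysics.QuantumFieldTheory.Balaban1983to89.FlowStepRuns (genFlow genSeq genSeq_zero)
open Literature.MathematicalPhysics.QuantumFieldTheory.Balaban1983to89.FlowStep (HBeta prefixOf RGEqH)
open Summit.QuantumFields.YangMills.BalabanUVNodes.N13UV01LevelZeroAtRecord13
  (uv_upper_zero_of_negE_le uv_lower_zero_of_E_le tstarCount_P_nonneg sum_tstarCount_P_range)
open Summit.QuantumFields.YangMills.BalabanUVNodes.N13UV01LevelZeroAtRecord13SignFree (log_inv_le_log_inv_add_of_inv_sq_le)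
open Summit.QuantumFields.YangMills.BalabanUVNodes.N13UV01LevelZeroOfPartialSumFloorAtRecord13
  (partialSumFloor_nonneg_of_inInterval inv_sq_gOfRecord₁₃_le_of_inInterval_of_runPartialSumFloor)
open Summit.QuantumFields.YangMills.BalabanUVNodes.N13NormalisationNoGoCouplingBlindAtRecord13SepCoPHV (dimSU_cast)

variable {F : T4Family} {N : ℕ} [NeZero N]

/-! ## §1 Bookkeeping: site numbers under blocking -/
omit [NeZero N] in
/-- **`|T₁^{(j)}| − |T₁^{(j+1)}| = (L⁴ − 1)·|T₁^{(j+1)}|` in the standing range** (`|T₁^{(j)}| = L⁴·|T₁^{(j+1)}|`, `Site.card_site_eq_mul_succ`): the volume factor of the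
`log z` term of (1.15) is one quarter of the bond count `|T^{(j)*}|`. [cite: Balaban1988Convergent, (1.15) p.249 (bookkeeping)] -/
theorem sitesCard_sub_succ_eq {K j : ℕ} (hj : j + 1 ≤ F.m + K) :
    sitesCard (F.P K) j - sitesCard (F.P K) (j + 1) = (((F.P K).L : ℝ) ^ 4 - 1) * sitesCard (F.P K) (j + 1) := by
  unfold sitesCard
  have h' : (Fintype.card (Site (F.P K) j) : ℝ) = ((F.P K).L : ℝ) ^ 4 * (Fintype.card (Site (F.P K) (j + 1)) : ℝ) := by
    rw [Site.card_site_eq_mul_succ (P := F.P K) (j := j) (by simpa using hj), show (F.P K).d = 4 by simp]; push_cast; ring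
  rw [h']; ring

omit [NeZero N] in
/-- `|T^{(j)*}| = 4·(|T₁^{(j)}| − |T₁^{(j+1)}|)` (the reader's bond count, by definition of `tstarCount`). [cite: Balaban1988Convergent, (1.15) p.249 (bookkeeping)] -/
theorem tstarCount_eq_four_mul_sub (K j : ℕ) : tstarCount (F.P K) j = 4 * (sitesCard (F.P K) j - sitesCard (F.P K) (j + 1)) := by
  unfold tstarCount; ring

omit [NeZero N] in
/-- `0 ≤ |T₁^{(j)}| − |T₁^{(j+1)}|` in the standing range. [cite: Balaban1988Convergent, (1.15) p.249 (bookkeeping)] -/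
theorem sitesCard_sub_succ_nonneg {K j : ℕ} (hj : j + 1 ≤ F.m + K) : 0 ≤ sitesCard (F.P K) j - sitesCard (F.P K) (j + 1) := by
  have h := tstarCount_P_nonneg (F := F) (K := K) (j := j) hj
  rw [tstarCount_eq_four_mul_sub] at h
  linarith

omit [NeZero N] in
/-- **`Σ_{j<K} |T₁^{(j+1)}| ≤ |T₁^{(0)}|∕15`** on Bałaban's tori (`(L⁴ − 1)·Σ_{j<K}|T₁^{(j+1)}| = |T₁^{(0)}| − |T₁^{(K)}|`, `L ≥ 2`). [cite: Balaban1988Convergent, p.245 (blocking; bookkeeping)] -/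
theorem sum_sitesCard_succ_range_le (K : ℕ) :
    ∑ j ∈ Finset.range K, sitesCard (F.P K) (j + 1) ≤ sitesCard (F.P K) 0 / 15 := by
  have hL2 : (2 : ℝ) ≤ ((F.P K).L : ℝ) := by rw [show (F.P K).L = F.L by simp]; exact_mod_cast F.hL.2
  have hL4 : (16 : ℝ) ≤ ((F.P K).L : ℝ) ^ 4 := by nlinarith [pow_le_pow_left₀ (by norm_num : (0 : ℝ) ≤ 2) hL2 4]
  have htel : (((F.P K).L : ℝ) ^ 4 - 1) * ∑ j ∈ Finset.range K, sitesCard (F.P K) (j + 1) = sitesCard (F.P K) 0 - sitesCard (F.P K) K := by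
    rw [Finset.mul_sum]
    have hc : ∀ j ∈ Finset.range K, (((F.P K).L : ℝ) ^ 4 - 1) * sitesCard (F.P K) (j + 1) = sitesCard (F.P K) j - sitesCard (F.P K) (j + 1) :=
      fun j hj => (sitesCard_sub_succ_eq (F := F) (by have := Finset.mem_range.mp hj; omega)).symm
    rw [Finset.sum_congr rfl hc, Finset.sum_range_sub' (fun j => sitesCard (F.P K) j) K]
  have hK : 0 ≤ sitesCard (F.P K) K := Nat.cast_nonneg _
  have hS : 0 ≤ ∑ j ∈ Finset.range K, sitesCard (F.P K) (j + 1) := Finset.sum_nonneg fun j _ => Nat.cast_nonneg _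
  rw [le_div_iff₀ (by norm_num : (0 : ℝ) < 15)]
  nlinarith

/-! ## §2 The one-step vacuum-energy expression `e_j` of (1.15) under the displayed normalisation items -/

section PerStep

variable (θ : Stage13Params F N) (P : B12.RunParams)

/-- Unfolding `e_j` with the `log z` volume factor rewritten as `|T₁^{(j)}| − |T₁^{(j+1)}|` (standing range `j < K`):
`e_j = (4·d(𝔤)·log g_j + 4·log σ₀ − logz_j)·(|T₁^{(j)}| − |T₁^{(j+1)}|) + Efl_j`. [cite: Balaban1988Convergent, (1.15) p.249; p.254] -/
theorem eStepOfRecord_eq_of_lt {j : ℕ} (hj : j < P.K) :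
    eStepOfRecord N θ.ν (θ.Efl P) (θ.logz P) (gOfRecord₁₃ F N θ P) (F.P P.K) j =
      (4 * ((dimSU N : ℕ) : ℝ) * Real.log (gOfRecord₁₃ F N θ P j) + 4 * θ.ν.logσ₀ - θ.logz P j)
          * (sitesCard (F.P P.K) j - sitesCard (F.P P.K) (j + 1)) + θ.Efl P j := by
  have hΔ := sitesCard_sub_succ_eq (F := F) (K := P.K) (j := j) (by omega)
  unfold eStepOfRecord
  rw [← hΔ, tstarCount_eq_four_mul_sub]
  ring

/-- **UPPER BOUND ON `e_j`** from the z-LOWER item `aL·log g_j − CzL ≤ logz_j` (`aL ≤ 4·d(𝔤)`) and the Efl-UPPER item `Efl_j ≤ CEU·|T₁^{(j+1)}|`, at a coupling `0 < g_j ≤ 1`: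
`e_j ≤ (4·max(log σ₀, 0) + CzL)·(|T₁^{(j)}| − |T₁^{(j+1)}|) + CEU·|T₁^{(j+1)}|` (the logarithm `(4d(𝔤) − aL)·log g_j ≤ 0` is dropped).
[cite: Balaban1988Convergent, (1.15) p.249; Balaban1987RG1, (0.15) p.254, (2.13)–(2.14) p.268 (the shape of the items)] -/
theorem eStepOfRecord_le_of_zLower_of_eflUpper {j : ℕ} (hj : j < P.K)
    (hg : 0 < gOfRecord₁₃ F N θ P j ∧ gOfRecord₁₃ F N θ P j ≤ 1) {aL CzL CEU : ℝ} (haL : aL ≤ 4 * ((dimSU N : ℕ) : ℝ))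
    (hzL : aL * Real.log (gOfRecord₁₃ F N θ P j) - CzL ≤ θ.logz P j) (hEU : θ.Efl P j ≤ CEU * sitesCard (F.P P.K) (j + 1)) :
    eStepOfRecord N θ.ν (θ.Efl P) (θ.logz P) (gOfRecord₁₃ F N θ P) (F.P P.K) j ≤
      (4 * max θ.ν.logσ₀ 0 + CzL) * (sitesCard (F.P P.K) j - sitesCard (F.P P.K) (j + 1)) + CEU * sitesCard (F.P P.K) (j + 1) := by
  rw [eStepOfRecord_eq_of_lt θ P hj]
  have hΔ : 0 ≤ sitesCard (F.P P.K) j - sitesCard (F.P P.K) (j + 1) := sitesCard_sub_succ_nonneg (F := F) (by omega)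
  have hlog : Real.log (gOfRecord₁₃ F N θ P j) ≤ 0 := Real.log_nonpos hg.1.le hg.2
  have h1 : (4 * ((dimSU N : ℕ) : ℝ) - aL) * Real.log (gOfRecord₁₃ F N θ P j) ≤ 0 :=
    mul_nonpos_of_nonneg_of_nonpos (by linarith) hlog
  have hcoef : 4 * ((dimSU N : ℕ) : ℝ) * Real.log (gOfRecord₁₃ F N θ P j) + 4 * θ.ν.logσ₀ - θ.logz P j ≤ 4 * max θ.ν.logσ₀ 0 + CzL := by
    linarith [le_max_left θ.ν.logσ₀ 0]
  have := mul_le_mul_of_nonneg_right hcoef hΔ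
  linarith

/-- **UPPER BOUND ON `−e_j`** from the z-UPPER item `logz_j ≤ aU·log g_j + CzU` (`aU ≤ 4·d(𝔤)`), the Efl-LOWER item `−CEL·|T₁^{(j+1)}| ≤ Efl_j` and a logarithmic ceiling `log g_j⁻¹ ≤ ℓ`:
`−e_j ≤ ((4d(𝔤) − aU)·ℓ + 4·max(−log σ₀, 0) + CzU)·(|T₁^{(j)}| − |T₁^{(j+1)}|) + CEL·|T₁^{(j+1)}|`.
[cite: Balaban1988Convergent, (1.15) p.249; Balaban1987RG1, (0.15) p.254, (2.13)–(2.14) p.268 (the shape of the items)] -/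
theorem neg_eStepOfRecord_le_of_zUpper_of_eflLower {j : ℕ} (hj : j < P.K) {aU CzU CEL ℓ : ℝ} (haU : aU ≤ 4 * ((dimSU N : ℕ) : ℝ))
    (hzU : θ.logz P j ≤ aU * Real.log (gOfRecord₁₃ F N θ P j) + CzU) (hEL : -(CEL * sitesCard (F.P P.K) (j + 1)) ≤ θ.Efl P j)
    (hℓ : Real.log (gOfRecord₁₃ F N θ P j)⁻¹ ≤ ℓ) :
    -(eStepOfRecord N θ.ν (θ.Efl P) (θ.logz P) (gOfRecord₁₃ F N θ P) (F.P P.K) j) ≤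
      ((4 * ((dimSU N : ℕ) : ℝ) - aU) * ℓ + 4 * max (-θ.ν.logσ₀) 0 + CzU) * (sitesCard (F.P P.K) j - sitesCard (F.P P.K) (j + 1))
        + CEL * sitesCard (F.P P.K) (j + 1) := by
  rw [eStepOfRecord_eq_of_lt θ P hj]
  have hΔ : 0 ≤ sitesCard (F.P P.K) j - sitesCard (F.P P.K) (j + 1) := sitesCard_sub_succ_nonneg (F := F) (by omega)
  rw [Real.log_inv] at hℓ
  have h1 : (4 * ((dimSU N : ℕ) : ℝ) - aU) * (-Real.log (gOfRecord₁₃ F N θ P j)) ≤ (4 * ((dimSU N : ℕ) : ℝ) - aU) * ℓ :=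
    mul_le_mul_of_nonneg_left hℓ (by linarith)
  have hcoef : -(4 * ((dimSU N : ℕ) : ℝ) * Real.log (gOfRecord₁₃ F N θ P j) + 4 * θ.ν.logσ₀ - θ.logz P j)
      ≤ (4 * ((dimSU N : ℕ) : ℝ) - aU) * ℓ + 4 * max (-θ.ν.logσ₀) 0 + CzU := by
    linarith [le_max_left (-θ.ν.logσ₀) 0]
  have := mul_le_mul_of_nonneg_right hcoef hΔ
  linarith

end PerStep

/-! ## §3 The normalisation `E(P) = Σ_{j<K} e_j` along a γ-windowed run: two-sided bounds by `|T₁^{(0)}|` -/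

section EBounds

variable (θ : Stage13Params F N) (P : B12.RunParams)

/-- ★ **`E(P) ≤ (4·max(log σ₀,0) + CzL + CEU)·|T₁^{(0)}|` ALONG A γ-WINDOWED RUN** (`0 < g_j ≤ γ ≤ 1`), from the z-LOWER item (`aL ≤ 4d(𝔤)`, `0 ≤ CzL`) and the Efl-UPPER item
(`0 ≤ CEU`) at every step `j < K`: sum §2 over the scales, telescope `Σ_j (|T₁^{(j)}| − |T₁^{(j+1)}|) = |T₁^{(0)}| − |T₁^{(K)}|`, `Σ_j |T₁^{(j+1)}| ≤ |T₁^{(0)}|∕15`.  The coupling-blind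
class (`logz = Efl = 0`: `aL = CzL = CEU = 0`) recovers p586609's `E ≤ 4·max(log σ₀,0)·|T₁^{(0)}|`. [cite: Balaban1988Convergent, Thm 1 p.262, (1.15) p.249; Balaban1987RG1, (0.15) p.254] -/
theorem EOfRecord₁₃_le_of_inInterval_of_zLower_of_eflUpper {γ : ℝ} (hγ : γ ≤ 1) (hI : (genFlow (betaOfRecord₁₃ F N θ) P.g0).InInterval γ P.K)
    {aL CzL CEU : ℝ} (haL : aL ≤ 4 * ((dimSU N : ℕ) : ℝ)) (hCzL : 0 ≤ CzL) (hCEU : 0 ≤ CEU)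
    (hzL : ∀ j, j < P.K → aL * Real.log (gOfRecord₁₃ F N θ P j) - CzL ≤ θ.logz P j)
    (hEU : ∀ j, j < P.K → θ.Efl P j ≤ CEU * sitesCard (F.P P.K) (j + 1)) :
    EOfRecord₁₃ F N θ P ≤ (4 * max θ.ν.logσ₀ 0 + CzL + CEU) * (Fintype.card (Site (F.P P.K) 0) : ℝ) := by
  have hE : EOfRecord₁₃ F N θ P = ∑ j ∈ Finset.range P.K, eStepOfRecord N θ.ν (θ.Efl P) (θ.logz P) (gOfRecord₁₃ F N θ P) (F.P P.K) j := rfl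
  have hstep : ∀ j ∈ Finset.range P.K, eStepOfRecord N θ.ν (θ.Efl P) (θ.logz P) (gOfRecord₁₃ F N θ P) (F.P P.K) j ≤
      (4 * max θ.ν.logσ₀ 0 + CzL) * (sitesCard (F.P P.K) j - sitesCard (F.P P.K) (j + 1)) + CEU * sitesCard (F.P P.K) (j + 1) := by
    intro j hjm
    have hj : j < P.K := Finset.mem_range.mp hjm
    exact eStepOfRecord_le_of_zLower_of_eflUpper θ P hj ⟨(hI j hj.le).1, (hI j hj.le).2.trans hγ⟩ haL (hzL j hj) (hEU j hj)
  rw [hE]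
  refine (Finset.sum_le_sum hstep).trans ?_
  rw [Finset.sum_add_distrib, ← Finset.mul_sum, ← Finset.mul_sum, Finset.sum_range_sub' (fun j => sitesCard (F.P P.K) j) P.K]
  have hsucc := sum_sitesCard_succ_range_le (F := F) P.K
  have hK : 0 ≤ sitesCard (F.P P.K) P.K := Nat.cast_nonneg _
  have h0 : 0 ≤ sitesCard (F.P P.K) 0 := Nat.cast_nonneg _
  have hm : 0 ≤ 4 * max θ.ν.logσ₀ 0 + CzL := by linarith [le_max_right θ.ν.logσ₀ 0]
  rw [← show sitesCard (F.P P.K) 0 = (Fintype.card (Site (F.P P.K) 0) : ℝ) from rfl]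
  nlinarith [mul_le_mul_of_nonneg_left hsucc hCEU, hm, hK, h0]

/-- ★ **`−E(P) ≤ ((4d(𝔤) − aU)·(log g₀⁻¹ + M∕2) + 4·max(−log σ₀,0) + CzU + CEL)·|T₁^{(0)}|` ALONG A γ-WINDOWED RUN WHOSE COUPLINGS OBEY THE FLOOR `g_j⁻² ≤ g₀⁻² + M`** (`γ ≤ 1`,
`0 ≤ M`; the floor is K1⁹'s row (iv) read along the run, p632548 §1), from the z-UPPER item (`aU ≤ 4d(𝔤)`, `0 ≤ CzU`) and the Efl-LOWER item (`0 ≤ CEL`) at every step `j < K`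
(`log g_j⁻¹ ≤ log g₀⁻¹ + M∕2` by p590719's logarithmic step).  With `aU = 0 = CzU = CEL` this is p632548 §2 (coefficient `4d(𝔤)`); with the Laplace-sharp `aU = d(𝔤)` the
coefficient is the Gaussian `3d(𝔤)`. [cite: Balaban1988Convergent, Thm 1 p.262, (1.15) p.249; Balaban1987RG1, (0.15) p.254, (0.20) p.256] -/
theorem neg_EOfRecord₁₃_le_of_inInterval_of_invSqFloor_of_zUpper_of_eflLower {γ M : ℝ} (hγ : γ ≤ 1) (hM : 0 ≤ M)
    (hfl : ∀ j, j ≤ P.K → (gOfRecord₁₃ F N θ P j ^ 2)⁻¹ ≤ (P.g0 ^ 2)⁻¹ + M)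
    (hI : (genFlow (betaOfRecord₁₃ F N θ) P.g0).InInterval γ P.K)
    {aU CzU CEL : ℝ} (haU : aU ≤ 4 * ((dimSU N : ℕ) : ℝ)) (hCzU : 0 ≤ CzU) (hCEL : 0 ≤ CEL)
    (hzU : ∀ j, j < P.K → θ.logz P j ≤ aU * Real.log (gOfRecord₁₃ F N θ P j) + CzU)
    (hEL : ∀ j, j < P.K → -(CEL * sitesCard (F.P P.K) (j + 1)) ≤ θ.Efl P j) :
    -(EOfRecord₁₃ F N θ P) ≤
      ((4 * ((dimSU N : ℕ) : ℝ) - aU) * (Real.log P.g0⁻¹ + M / 2) + 4 * max (-θ.ν.logσ₀) 0 + CzU + CEL) * (Fintype.card (Site (F.P P.K) 0) : ℝ) := by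
  have hE : EOfRecord₁₃ F N θ P = ∑ j ∈ Finset.range P.K, eStepOfRecord N θ.ν (θ.Efl P) (θ.logz P) (gOfRecord₁₃ F N θ P) (F.P P.K) j := rfl
  have hg0eq : gOfRecord₁₃ F N θ P 0 = P.g0 := genSeq_zero _ _
  have hg0pos : 0 < P.g0 := hg0eq ▸ (hI 0 (Nat.zero_le _)).1
  have hg0le : P.g0 ≤ 1 := hg0eq ▸ ((hI 0 (Nat.zero_le _)).2.trans hγ)
  have hlog0 : 0 ≤ Real.log P.g0⁻¹ := Real.log_nonneg ((one_le_inv₀ hg0pos).mpr hg0le)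
  have hstep : ∀ j ∈ Finset.range P.K, -(eStepOfRecord N θ.ν (θ.Efl P) (θ.logz P) (gOfRecord₁₃ F N θ P) (F.P P.K) j) ≤
      ((4 * ((dimSU N : ℕ) : ℝ) - aU) * (Real.log P.g0⁻¹ + M / 2) + 4 * max (-θ.ν.logσ₀) 0 + CzU) * (sitesCard (F.P P.K) j - sitesCard (F.P P.K) (j + 1))
        + CEL * sitesCard (F.P P.K) (j + 1) := by
    intro j hjm
    have hj : j < P.K := Finset.mem_range.mp hjm
    exact neg_eStepOfRecord_le_of_zUpper_of_eflLower θ P hj haU (hzU j hj) (hEL j hj)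
      (log_inv_le_log_inv_add_of_inv_sq_le (hI j hj.le).1 hg0pos hg0le hM (hfl j hj.le))
  rw [hE, ← Finset.sum_neg_distrib]
  refine (Finset.sum_le_sum hstep).trans ?_
  rw [Finset.sum_add_distrib, ← Finset.mul_sum, ← Finset.mul_sum, Finset.sum_range_sub' (fun j => sitesCard (F.P P.K) j) P.K]
  have hsucc := sum_sitesCard_succ_range_le (F := F) P.K
  have hK : 0 ≤ sitesCard (F.P P.K) P.K := Nat.cast_nonneg _
  have h0 : 0 ≤ sitesCard (F.P P.K) 0 := Nat.cast_nonneg _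
  have hm : 0 ≤ (4 * ((dimSU N : ℕ) : ℝ) - aU) * (Real.log P.g0⁻¹ + M / 2) + 4 * max (-θ.ν.logσ₀) 0 + CzU := by
    have : 0 ≤ (4 * ((dimSU N : ℕ) : ℝ) - aU) * (Real.log P.g0⁻¹ + M / 2) := mul_nonneg (by linarith) (by linarith)
    linarith [le_max_right (-θ.ν.logσ₀) 0]
  rw [← show sitesCard (F.P P.K) 0 = (Fintype.card (Site (F.P P.K) 0) : ℝ) from rfl]
  nlinarith [mul_le_mul_of_nonneg_left hsucc hCEL, hm, hK, h0]

end EBounds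

/-! ## §4 ★★ (2.50) at level `0` under the normalisation items: both sides, engines' currency and [B16]'s carrier -/

section LevelZero

variable (θ : Stage13Params F N) (P : B12.RunParams)

/-- **★★ THE LEVEL-`0` CONJUNCT OF N13's (UV₁₃) ROW, BOTH SIDES, UNDER THE FOUR NORMALISATION ITEMS AND THE COUPLING FLOOR** (`γ ≤ 1`, `0 ≤ M`, `g_j⁻² ≤ g₀⁻² + M`):
`χβ₀·exp(−g₀⁻²·A^η₀ − em·|T₁^{(0)}|) ≤ ρ₀ ≤ exp(ep·|T₁^{(0)}|)` with `em = 4·max(log σ₀,0) + CzL + CEU + 12·g₀⁻²` and `ep = (4d(𝔤) − aU)·(log g₀⁻¹ + M∕2) + 4·max(−log σ₀,0) + CzU + CEL`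
— functions of `g₀ = g_k|_{k=0}` and the item constants alone.  p632548 §3 is the instance `a = C = 0`.
[cite: Balaban1989LargeFieldII, (0.1) pp.355–356; Balaban1988Convergent, Cor. 3 (2.50) p.264, Thm 1 p.262, (1.15) p.249; Balaban1987RG1, (0.15) p.254, (0.20) p.256] -/
theorem uv_zero_densOfRecord₁₃_of_normLetters_of_inInterval_of_invSqFloor {γ M : ℝ} (hγ : γ ≤ 1) (hM : 0 ≤ M)
    (hfl : ∀ j, j ≤ P.K → (gOfRecord₁₃ F N θ P j ^ 2)⁻¹ ≤ (P.g0 ^ 2)⁻¹ + M)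
    (hI : (genFlow (betaOfRecord₁₃ F N θ) P.g0).InInterval γ P.K)
    {aL aU CzL CzU CEL CEU : ℝ} (haL : aL ≤ 4 * ((dimSU N : ℕ) : ℝ)) (haU : aU ≤ 4 * ((dimSU N : ℕ) : ℝ))
    (hCzL : 0 ≤ CzL) (hCzU : 0 ≤ CzU) (hCEL : 0 ≤ CEL) (hCEU : 0 ≤ CEU)
    (hzL : ∀ j, j < P.K → aL * Real.log (gOfRecord₁₃ F N θ P j) - CzL ≤ θ.logz P j)
    (hzU : ∀ j, j < P.K → θ.logz P j ≤ aU * Real.log (gOfRecord₁₃ F N θ P j) + CzU)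
    (hEL : ∀ j, j < P.K → -(CEL * sitesCard (F.P P.K) (j + 1)) ≤ θ.Efl P j)
    (hEU : ∀ j, j < P.K → θ.Efl P j ≤ CEU * sitesCard (F.P P.K) (j + 1))
    (U : GaugeField (F.P P.K) 0 (SU N)) :
    chiβOfRecord₁₃ F N θ P.K (gOfRecord₁₃ F N θ P) 0 U *
          Real.exp (-(1 / (gOfRecord₁₃ F N θ P 0)) ^ 2 * wilsonBGOfRecord F N θ.εbg P 0 U
            - (4 * max θ.ν.logσ₀ 0 + CzL + CEU + 12 * (1 / gOfRecord₁₃ F N θ P 0) ^ 2) * (Fintype.card (Site (F.P P.K) 0) : ℝ)) ≤ densOfRecord₁₃ F N θ P 0 U ∧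
      densOfRecord₁₃ F N θ P 0 U ≤
        Real.exp (((4 * ((dimSU N : ℕ) : ℝ) - aU) * (Real.log (gOfRecord₁₃ F N θ P 0)⁻¹ + M / 2) + 4 * max (-θ.ν.logσ₀) 0 + CzU + CEL)
          * (Fintype.card (Site (F.P P.K) 0) : ℝ)) := by
  have hg0 : gOfRecord₁₃ F N θ P 0 = P.g0 := genSeq_zero _ _
  refine ⟨?_, ?_⟩
  · have h := uv_lower_zero_of_E_le θ P (EOfRecord₁₃_le_of_inInterval_of_zLower_of_eflUpper θ P hγ hI haL hCzL hCEU hzL hEU) U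
    rw [hg0] at h ⊢
    exact h
  · rw [hg0]
    exact uv_upper_zero_of_negE_le θ P (neg_EOfRecord₁₃_le_of_inInterval_of_invSqFloor_of_zUpper_of_eflLower θ P hγ hM hfl hI haU hCzU hCEL hzU hEL) U

end LevelZero
section Datum

variable (θ : Stage13HParams F N) (h : θ.Provisos₁₃CoPH F N) (P : B12.RunParams)

/-- **(0.1) ∕ (2.50) AT LEVEL `0` AT THE CONSTRUCTION OF RECORD UNDER THE FOUR ITEMS AND THE COUPLING FLOOR**, in [B16]'s carrier `B16.UVIneq` with `E₋ = em`, `E₊ = ep` of §4 — through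
dag-n24-c's `B16NodeKnitRecord13CoPH.uvIneq_at_record₁₃CoPH_iff`. [cite: Balaban1989LargeFieldII, (0.1) p.356; Balaban1988Convergent, (2.50) p.264] -/
theorem uvIneq_zero_datumOfRecord₁₃CoPH_of_normLetters_of_inInterval_of_invSqFloor {γ M : ℝ} (hγ : γ ≤ 1) (hM : 0 ≤ M)
    (hfl : ∀ j, j ≤ P.K → (gOfRecord₁₃ F N θ.toStage13Params P j ^ 2)⁻¹ ≤ (P.g0 ^ 2)⁻¹ + M)
    (hI : (genFlow (betaOfRecord₁₃ F N θ.toStage13Params) P.g0).InInterval γ P.K)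
    {aL aU CzL CzU CEL CEU : ℝ} (haL : aL ≤ 4 * ((dimSU N : ℕ) : ℝ)) (haU : aU ≤ 4 * ((dimSU N : ℕ) : ℝ))
    (hCzL : 0 ≤ CzL) (hCzU : 0 ≤ CzU) (hCEL : 0 ≤ CEL) (hCEU : 0 ≤ CEU)
    (hzL : ∀ j, j < P.K → aL * Real.log (gOfRecord₁₃ F N θ.toStage13Params P j) - CzL ≤ θ.logz P j)
    (hzU : ∀ j, j < P.K → θ.logz P j ≤ aU * Real.log (gOfRecord₁₃ F N θ.toStage13Params P j) + CzU)
    (hEL : ∀ j, j < P.K → -(CEL * sitesCard (F.P P.K) (j + 1)) ≤ θ.Efl P j)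
    (hEU : ∀ j, j < P.K → θ.Efl P j ≤ CEU * sitesCard (F.P P.K) (j + 1))
    (V : GaugeField (F.P P.K) 0 (SU N)) :
    B16.UVIneq ((datumOfRecord₁₃CoPH F N θ h).C P) 0 V
      (4 * max θ.ν.logσ₀ 0 + CzL + CEU + 12 * (1 / gOfRecord₁₃ F N θ.toStage13Params P 0) ^ 2)
      ((4 * ((dimSU N : ℕ) : ℝ) - aU) * (Real.log (gOfRecord₁₃ F N θ.toStage13Params P 0)⁻¹ + M / 2) + 4 * max (-θ.ν.logσ₀) 0 + CzU + CEL) := by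
  have h0 := uv_zero_densOfRecord₁₃_of_normLetters_of_inInterval_of_invSqFloor θ.toStage13Params P hγ hM hfl hI haL haU hCzL hCzU hCEL hCEU hzL hzU hEL hEU V
  refine (B16NodeKnitRecord13CoPH.uvIneq_at_record₁₃CoPH_iff F N θ h P 0 V _ _).mpr ⟨?_, h0.2⟩
  convert h0.1 using 3
  ring

/-- **★★ (2.50) AT LEVEL `0` AT THE CONSTRUCTION OF RECORD FROM ROW (iv) IN THE ITEM's INLINE SPELLING + THE FOUR ITEMS** — on every γ-windowed run with `γ ≤ 1`, `γ ≤ γ₀`, given the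
run-wise partial-sum floor of `β_θ` at level `γ₀` with constant `M` (K1⁹'s row (iv) verbatim; p632548 §1 turns it into the coupling floor, `0 ≤ M`): (2.50) at `k = 0` for EVERY field.
[cite: Balaban1989LargeFieldII, (0.1) p.356; Balaban1988Convergent, (2.50) p.264, Thm 1 p.262; Balaban1987RG1, (0.20) p.256, Thm 2 p.259, (0.15) p.254] -/
theorem uvIneq_zero_datumOfRecord₁₃CoPH_of_normLetters_of_inInterval_of_runPartialSumFloor {γ γ₀ M : ℝ} (hγ : γ ≤ 1) (hγ₀ : γ ≤ γ₀)
    (hps : ∀ (n : ℕ) (gs : ℕ → ℝ), RGEqH n (betaOfRecord₁₃ F N θ.toStage13Params) gs → Step.InInterval γ₀ n gs →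
      ∀ k, k ≤ n → -M ≤ ∑ j ∈ Finset.Ico k n, betaOfRecord₁₃ F N θ.toStage13Params j (prefixOf gs j))
    (hI : (genFlow (betaOfRecord₁₃ F N θ.toStage13Params) P.g0).InInterval γ P.K)
    {aL aU CzL CzU CEL CEU : ℝ} (haL : aL ≤ 4 * ((dimSU N : ℕ) : ℝ)) (haU : aU ≤ 4 * ((dimSU N : ℕ) : ℝ))
    (hCzL : 0 ≤ CzL) (hCzU : 0 ≤ CzU) (hCEL : 0 ≤ CEL) (hCEU : 0 ≤ CEU)
    (hzL : ∀ j, j < P.K → aL * Real.log (gOfRecord₁₃ F N θ.toStage13Params P j) - CzL ≤ θ.logz P j)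
    (hzU : ∀ j, j < P.K → θ.logz P j ≤ aU * Real.log (gOfRecord₁₃ F N θ.toStage13Params P j) + CzU)
    (hEL : ∀ j, j < P.K → -(CEL * sitesCard (F.P P.K) (j + 1)) ≤ θ.Efl P j)
    (hEU : ∀ j, j < P.K → θ.Efl P j ≤ CEU * sitesCard (F.P P.K) (j + 1))
    (V : GaugeField (F.P P.K) 0 (SU N)) :
    B16.UVIneq ((datumOfRecord₁₃CoPH F N θ h).C P) 0 V
      (4 * max θ.ν.logσ₀ 0 + CzL + CEU + 12 * (1 / gOfRecord₁₃ F N θ.toStage13Params P 0) ^ 2)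
      ((4 * ((dimSU N : ℕ) : ℝ) - aU) * (Real.log (gOfRecord₁₃ F N θ.toStage13Params P 0)⁻¹ + M / 2) + 4 * max (-θ.ν.logσ₀) 0 + CzU + CEL) :=
  uvIneq_zero_datumOfRecord₁₃CoPH_of_normLetters_of_inInterval_of_invSqFloor θ h P hγ
    (partialSumFloor_nonneg_of_inInterval θ.toStage13Params P hγ₀ hps hI)
    (inv_sq_gOfRecord₁₃_le_of_inInterval_of_runPartialSumFloor θ.toStage13Params P hγ₀ hps hI) hI haL haU hCzL hCzU hCEL hCEU hzL hzU hEL hEU V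

end Datum

/-! ## §5 Bridges: the coupling-blind instance; the tree's `CountertermData` predicates; print's `z` of [I] (0.15) on `SU(N)` meets the z-items -/

section Bridges

variable (θ : Stage13Params F N) (P : B12.RunParams)

/-- **THE COUPLING-BLIND CLASS IS THE DEGENERATE INSTANCE `a = C = 0`**: at `Efl = logz = 0` (the tree's K0-class witnesses, `Record12NumericsFamilyDict` :113–114) all four items hold with
every constant `0` — so p632548 §2–§4 are instances of §3–§4 (that instance is FLAG №9's vacuous-in-regime class; the parents are not). [cite: Balaban1988Convergent, (1.15) p.249 (bookkeeping)] -/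
theorem normLetters_of_Efl_logz_zero (hEfl : ∀ j, θ.Efl P j = 0) (hlogz : ∀ j, θ.logz P j = 0) (j : ℕ) :
    ((0 : ℝ) * Real.log (gOfRecord₁₃ F N θ P j) - 0 ≤ θ.logz P j ∧ θ.logz P j ≤ (0 : ℝ) * Real.log (gOfRecord₁₃ F N θ P j) + 0) ∧
      (-((0 : ℝ) * sitesCard (F.P P.K) (j + 1)) ≤ θ.Efl P j ∧ θ.Efl P j ≤ (0 : ℝ) * sitesCard (F.P P.K) (j + 1)) := by
  simp [hEfl j, hlogz j]

/-- **THE TREE's READER's ITEM `CountertermData.ZLower Cz` ON THE RECORD's CARRIER IS THE z-LOWER ITEM WITH print's COEFFICIENT `aL = d(𝔤)`** (`B16B10Shape` §4, `SmallFieldChiOfRecord.countertermDataOfRecord`;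
definitional). [cite: Balaban1987RG1, (0.14)–(0.17) pp.254–255; Balaban1988Convergent, (1.15) p.249] -/
theorem countertermDataOfRecord_zLower_iff (Cz : ℝ) :
    (countertermDataOfRecord F N θ.ν θ.Efl θ.logz (fun p => gOfRecord₁₃ F N θ p) P).ZLower Cz ↔
      ∀ j, j < P.K → ((dimSU N : ℕ) : ℝ) * Real.log (gOfRecord₁₃ F N θ P j) - Cz ≤ θ.logz P j := Iff.rfl

/-- **THE TREE's READER's ITEM `CountertermData.EflBound CE` ON THE RECORD's CARRIER IS THE Efl-UPPER ITEM** (definitional). [cite: Balaban1987RG1, (2.13)–(2.14) p.268; Balaban1988Convergent, p.254] -/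
theorem countertermDataOfRecord_eflBound_iff (CE : ℝ) :
    (countertermDataOfRecord F N θ.ν θ.Efl θ.logz (fun p => gOfRecord₁₃ F N θ p) P).EflBound CE ↔
      ∀ j, j < P.K → θ.Efl P j ≤ CE * sitesCard (F.P P.K) (j + 1) := Iff.rfl

omit [NeZero N] in
/-- print's coefficient is admissible: `d(𝔤) ≤ 4·d(𝔤)`. [folklore] -/
theorem dimSU_le_four_mul : ((dimSU N : ℕ) : ℝ) ≤ 4 * ((dimSU N : ℕ) : ℝ) := by linarith [(Nat.cast_nonneg _ : (0 : ℝ) ≤ ((dimSU N : ℕ) : ℝ))]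

/-- **`z ≤ 1`**: the integrand `exp[−(1∕α)(1 − Re tr u)]·χ` of [I] (0.15) is `≤ 1` (`Re tr u ≤ 1`) against the probability Haar measure, so the normalisation `z(α, ε₀)` of (0.15) is at most `1`
(`α > 0`) — the TRIVIAL z-upper item `log z ≤ 0` (`aU = CzU = 0`). [cite: Balaban1987RG1, (0.15) p.254 (elementary)] -/
theorem zNorm_SU_le_one {α : ℝ} (hα : 0 < α) (ε₀ : ℝ) : B16ZLower.zNorm (SU N) α ε₀ ≤ 1 := by
  haveI := HaarData.isProb (G := SU N)
  unfold B16ZLower.zNorm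
  set μ : Measure (SU N) := HaarData.haar with hμ
  set f : SU N → ℝ := fun u => Real.exp (-(1 / α) * (1 - GaugeGroup.reTr u)) with hf
  have hf1 : ∀ u, f u ≤ 1 := fun u => B16ZLower.gaugeFixIntegrand_le_one hα u
  have hf0 : ∀ u, 0 ≤ f u := fun u => B16ZLower.gaugeFixIntegrand_nonneg α u
  have hfi : Integrable f μ := Integrable.of_bound (B16ZLower.measurable_gaugeFixIntegrand α).aestronglyMeasurable 1
    (Filter.Eventually.of_forall fun u => by rw [Real.norm_eq_abs, abs_of_nonneg (hf0 u)]; exact hf1 u)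
  calc ∫ u in {u : SU N | GaugeGroup.dist1 u < ε₀}, f u ∂μ
      ≤ ∫ u, f u ∂μ := setIntegral_le_integral hfi (Filter.Eventually.of_forall hf0)
    _ ≤ ∫ _u, (1 : ℝ) ∂μ := integral_mono hfi (integrable_const 1) hf1
    _ = 1 := by simp

/-- `log z(g², ε₀) ≤ 0` on `SU(N)` for `g > 0`. [cite: Balaban1987RG1, (0.15) p.254 (elementary)] -/
theorem log_zNorm_SU_nonpos {g : ℝ} (hg : 0 < g) (ε₀ : ℝ) : Real.log (B16ZLower.zNorm (SU N) (g ^ 2) ε₀) ≤ 0 :=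
  Real.log_nonpos (B16ZLower.zNorm_nonneg _ _) (zNorm_SU_le_one (pow_pos hg 2) ε₀)

/-- ★ **PRINT's `z` OF [I] (0.15) MEETS BOTH z-ITEMS ON EVERY γ-WINDOWED RUN** (`γ ≤ 1`): if the witness's letter `logz_j` IS `log z(g_j², ε₀)` on `SU(N)` (the reader's identification `α = g_j²` of
(0.17)∕(0.19)), then the z-LOWER item holds with print's coefficient `aL = d(𝔤)` and `CzL = C_z^{SU}(N, ε₀)` (the tree's KERNEL theorem `B16ZLower.log_zNorm_specialUnitaryGroup_ge`) and the
z-UPPER item holds trivially with `aU = CzU = 0` (`z ≤ 1`).  So such a witness is NOT coupling-blind and §3–§4 apply to it with `−E`'s `|T₁^{(0)}|·log g₀⁻¹` coefficient `4d(𝔤)`.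
[cite: Balaban1987RG1, (0.14)–(0.17) pp.254–255] -/
theorem zItems_of_logz_eq_log_zNorm {ε₀ : ℝ} (hε : 0 < ε₀)
    (hz : ∀ j, j < P.K → θ.logz P j = Real.log (B16ZLower.zNorm (SU N) (gOfRecord₁₃ F N θ P j ^ 2) ε₀))
    {γ : ℝ} (hγ : γ ≤ 1) (hI : (genFlow (betaOfRecord₁₃ F N θ) P.g0).InInterval γ P.K) :
    (∀ j, j < P.K → ((dimSU N : ℕ) : ℝ) * Real.log (gOfRecord₁₃ F N θ P j) - B16ZLower.CzSU N ε₀ ≤ θ.logz P j) ∧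
      (∀ j, j < P.K → θ.logz P j ≤ (0 : ℝ) * Real.log (gOfRecord₁₃ F N θ P j) + 0) := by
  refine ⟨fun j hj => ?_, fun j hj => ?_⟩
  · have hg := hI j hj.le
    rw [hz j hj, dimSU_cast]
    exact B16ZLower.log_zNorm_specialUnitaryGroup_ge (N := N) hg.1 (hg.2.trans hγ) hε
  · have hg := hI j hj.le
    rw [hz j hj, zero_mul, zero_add]
    exact log_zNorm_SU_nonpos hg.1 ε₀

/-- ★★ **(2.50) AT LEVEL `0` AT A WITNESS WHOSE `logz` IS PRINT's `z` AND WHOSE `Efl` IS VOLUME-BOUNDED** (`|Efl_j| ≤ C_E·|T₁^{(j+1)}|`, the [I] (2.13)–(2.14) p.268 shape), along a γ-windowed run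
(`γ ≤ 1`) under the coupling floor: both sides with `em = 4·max(log σ₀,0) + C_z^{SU}(N,ε₀) + C_E + 12·g₀⁻²`, `ep = 4d(𝔤)·(log g₀⁻¹ + M∕2) + 4·max(−log σ₀,0) + C_E`.
[cite: Balaban1989LargeFieldII, (0.1) pp.355–356; Balaban1988Convergent, (2.50) p.264, Thm 1 p.262, (1.15) p.249; Balaban1987RG1, (0.15) p.254, (2.13)–(2.14) p.268, (0.20) p.256] -/
theorem uv_zero_densOfRecord₁₃_of_logz_zNorm_of_eflAbs_of_inInterval_of_invSqFloor {γ M ε₀ CE : ℝ} (hγ : γ ≤ 1) (hM : 0 ≤ M) (hε : 0 < ε₀) (hCE : 0 ≤ CE)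
    (hfl : ∀ j, j ≤ P.K → (gOfRecord₁₃ F N θ P j ^ 2)⁻¹ ≤ (P.g0 ^ 2)⁻¹ + M)
    (hI : (genFlow (betaOfRecord₁₃ F N θ) P.g0).InInterval γ P.K)
    (hz : ∀ j, j < P.K → θ.logz P j = Real.log (B16ZLower.zNorm (SU N) (gOfRecord₁₃ F N θ P j ^ 2) ε₀))
    (hE : ∀ j, j < P.K → |θ.Efl P j| ≤ CE * sitesCard (F.P P.K) (j + 1))
    (U : GaugeField (F.P P.K) 0 (SU N)) :
    chiβOfRecord₁₃ F N θ P.K (gOfRecord₁₃ F N θ P) 0 U *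
          Real.exp (-(1 / (gOfRecord₁₃ F N θ P 0)) ^ 2 * wilsonBGOfRecord F N θ.εbg P 0 U
            - (4 * max θ.ν.logσ₀ 0 + B16ZLower.CzSU N ε₀ + CE + 12 * (1 / gOfRecord₁₃ F N θ P 0) ^ 2) * (Fintype.card (Site (F.P P.K) 0) : ℝ)) ≤ densOfRecord₁₃ F N θ P 0 U ∧
      densOfRecord₁₃ F N θ P 0 U ≤
        Real.exp ((4 * ((dimSU N : ℕ) : ℝ) * (Real.log (gOfRecord₁₃ F N θ P 0)⁻¹ + M / 2) + 4 * max (-θ.ν.logσ₀) 0 + CE)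
          * (Fintype.card (Site (F.P P.K) 0) : ℝ)) := by
  have hz2 := zItems_of_logz_eq_log_zNorm θ P hε hz hγ hI
  have hd : (0 : ℝ) ≤ 4 * ((dimSU N : ℕ) : ℝ) := by have : (0 : ℝ) ≤ ((dimSU N : ℕ) : ℝ) := Nat.cast_nonneg _; linarith
  have h := uv_zero_densOfRecord₁₃_of_normLetters_of_inInterval_of_invSqFloor θ P hγ hM hfl hI dimSU_le_four_mul hd
    (B16ZLower.CzSU_nonneg (N := N) hε) le_rfl hCE hCE hz2.1 hz2.2
    (fun j hj => by have := hE j hj; have := neg_abs_le (θ.Efl P j); linarith) (fun j hj => (le_abs_self _).trans (hE j hj)) U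
  refine ⟨h.1, ?_⟩
  convert h.2 using 3
  ring

end Bridges

end Summit.QuantumFields.YangMills.BalabanUVNodes.N13UV01LevelZeroOfNormalisationLettersAtRecord13
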